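import Mathlib
import HarnessLib
import Summits.ResolutionOfSingularities.ResolutionOfSingularities.Theorems.WildQuotientsWildQuotientResolutionZ9PeeledTerminalLift
import Summits.ResolutionOfSingularities.ResolutionOfSingularities.Theorems.WildQuotientsWildQuotientResolutionJordanFiveChartW2RangeConversion

/-!
# ℤ9 SPECIMEN (peeled `𝔸⁴/ℤ9`, char 3), brick Z4b part 4c: fixed points transfer along the terminal ring model

(crux stmt-ResolutionOfSingularities-15640 `WildQuotients.WildQuotientResolution`, line `Sketch`; S1 =
stmt-ResolutionOfSingularities-17941 `CyclicQuotientFourfolds`; chain w45c card-P specimen «peeled 𝔸⁴/ℤ9», variant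
V-BR, brick Z4b part 4 (design `L/res-L1-w45c-stub-3/Z4B-PART4-DESIGN.md`, step (4-B)). [OURS · L1 W4.5c] — NOT a
statement of any manuscript; AI-produced, kernel-checked ≠ expert-reviewed. Def-free.)

For ANY injective ring model `e : (k[x][I₂₈ t])_{(s)} → L₂` of a `⟨σ̄⟩`-stable chart `D₊(s)`, `s = w t^m` with `σ̄ w = w`,
which is the terminal substitution on base elements (`e (F/1) = ι₂ (ψ₂ F)`, e.g. part 4b's `exists_awayNorm_ringEquiv`),
and ANY lift `σ̃ : L₂ →ₐ[k] L₂` with the terminal-lift laws: a section `y` is fixed by the graded automorphisms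
`φ_γ` (`γ ∈ ⟨σ̄⟩`) iff `σ̃ (e y) = e y` — lead-1's `BlowupExit.map_away_fixed_iff_of_intertwines` with the
intertwining `lift_comp_term`. What remains for the P₂ package is (4-C): res-D-pv-033's sections seam Ω at O = P₂.
-/

-- single-problem summit: the doubled namespace component `ResolutionOfSingularities` is forced
set_option linter.dupNamespace false

noncomputable section

open MvPolynomial Polynomial HomogeneousLocalization Literature.AlgebraicGeometry.Resolution

namespace Summit.ResolutionOfSingularities.ResolutionOfSingularities.Theorems.WildQuotientResolution.Z9Peeled.Terminal

variable (k : Type) [Field k] (n : ℕ) (a b c d : Fin n)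

/-- `v = 1 + s³ x_b′` (slots `s = X c`, `x_b′ = X b`; local shorthand). -/
local notation3 "v₂" => (1 + X c ^ 3 * X b : MvPolynomial (Fin n) k)
/-- `v' = 1 − s³ x_b′ + s⁶ x_a′` (local shorthand). -/
local notation3 "v₂'" => (1 - X c ^ 3 * X b + X c ^ 6 * X a : MvPolynomial (Fin n) k)
/-- `u₂ = v v'` expanded (local shorthand; the element inverted on the terminal piece). -/
local notation3 "u₂" => ((1 + X c ^ 3 * X b) * (1 - X c ^ 3 * X b + X c ^ 6 * X a) : MvPolynomial (Fin n) k)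
/-- The terminal chart ring `L₂ = k[x][(v v')⁻¹]` (local shorthand). -/
local notation3 "L₂" => Localization.Away
  ((1 + X c ^ 3 * X b) * (1 - X c ^ 3 * X b + X c ^ 6 * X a) : MvPolynomial (Fin n) k)
/-- `ι : k[x] → L₂` (local shorthand). -/
local notation3 "ι₂" => algebraMap (MvPolynomial (Fin n) k) (Localization.Away
  ((1 + X c ^ 3 * X b) * (1 - X c ^ 3 * X b + X c ^ 6 * X a) : MvPolynomial (Fin n) k))
/-- `J = (v v')⁻¹ ∈ L₂` (local shorthand). -/
local notation3 "J₂" => (IsLocalization.Away.invSelf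
  ((1 + X c ^ 3 * X b) * (1 - X c ^ 3 * X b + X c ^ 6 * X a) : MvPolynomial (Fin n) k) :
  Localization.Away ((1 + X c ^ 3 * X b) * (1 - X c ^ 3 * X b + X c ^ 6 * X a) : MvPolynomial (Fin n) k))
/-- `iv = (ι v)⁻¹ = ι v' · J` (local shorthand). -/
local notation3 "iv₂" => (algebraMap (MvPolynomial (Fin n) k) (Localization.Away
  ((1 + X c ^ 3 * X b) * (1 - X c ^ 3 * X b + X c ^ 6 * X a) : MvPolynomial (Fin n) k))
    (1 - X c ^ 3 * X b + X c ^ 6 * X a) *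
  (IsLocalization.Away.invSelf
    ((1 + X c ^ 3 * X b) * (1 - X c ^ 3 * X b + X c ^ 6 * X a) : MvPolynomial (Fin n) k) :
    Localization.Away ((1 + X c ^ 3 * X b) * (1 - X c ^ 3 * X b + X c ^ 6 * X a) : MvPolynomial (Fin n) k)))
/-- `iv' = (ι v')⁻¹ = ι v · J` (local shorthand). -/
local notation3 "iv₂'" => (algebraMap (MvPolynomial (Fin n) k) (Localization.Away
  ((1 + X c ^ 3 * X b) * (1 - X c ^ 3 * X b + X c ^ 6 * X a) : MvPolynomial (Fin n) k))
    (1 + X c ^ 3 * X b) *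
  (IsLocalization.Away.invSelf
    ((1 + X c ^ 3 * X b) * (1 - X c ^ 3 * X b + X c ^ 6 * X a) : MvPolynomial (Fin n) k) :
    Localization.Away ((1 + X c ^ 3 * X b) * (1 - X c ^ 3 * X b + X c ^ 6 * X a) : MvPolynomial (Fin n) k)))
/-- The terminal substitution `ψ₂` (local shorthand): `x_a ↦ x_a′ s⁷`, `x_b ↦ x_b′ s⁴`, rest fixed. -/
local notation3 "tm₂" => (fun i : Fin n => if i = a then X a * X c ^ 7
    else if i = b then X b * X c ^ 4 else (X i : MvPolynomial (Fin n) k))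


-- long law binders; head-room
set_option maxHeartbeats 1600000 in
/-- **(4-B) — fixed points along the terminal ring model.** [OURS · L1 W4.5c] -/
theorem terminal_map_away_fixed_iff
    (σ : MvPolynomial (Fin n) k ≃ₐ[k] MvPolynomial (Fin n) k) [Finite (Subgroup.zpowers σ)]
    (hb : σ (X b) = X b + X a) (hc : σ (X c) = X c + X b)
    (hd : σ (X d) = X d + X c ^ 3 - X a ^ 2 * X c)
    (hσ : ∀ i, i ≠ b → i ≠ c → i ≠ d → σ (X i) = X i)
    (hab : a ≠ b) (hac : a ≠ c) (had : a ≠ d) (hbc : b ≠ c) (hbd : b ≠ d)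
    {I : Ideal (MvPolynomial (Fin n) k)} (s : reesAlgebra I) {m : ℕ} (hs : s ∈ reesGrading I m)
    (w : MvPolynomial (Fin n) k) (hsw : (s : (MvPolynomial (Fin n) k)[X]) = monomial m w) (hw : σ w = w)
    (hw0 : aeval tm₂ w ≠ 0)
    (φ : (Subgroup.zpowers σ) → (reesGrading I →+*ᵍ reesGrading I))
    (hφ : ∀ (g : Subgroup.zpowers σ) x, ((φ g x : reesAlgebra I) : (MvPolynomial (Fin n) k)[X]) =
      (x : (MvPolynomial (Fin n) k)[X]).map
        ((MulSemiringAction.toRingEquiv (Subgroup.zpowers σ) (MvPolynomial (Fin n) k) g⁻¹ :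
          MvPolynomial (Fin n) k ≃+* MvPolynomial (Fin n) k) : MvPolynomial (Fin n) k →+* MvPolynomial (Fin n) k))
    (hP : ∀ g, Submonoid.powers s ≤ (Submonoid.powers s).comap (φ g))
    (e : HomogeneousLocalization.Away (reesGrading I) s →+* L₂) (he : Function.Injective e)
    (he_base : ∀ F : MvPolynomial (Fin n) k,
      e (((fromZeroRingHom (reesGrading I) (.powers s)).comp (reesGrading.zeroRingHom I)) F) =
        ι₂ (aeval tm₂ F))
    (τ : L₂ →ₐ[k] L₂)
    (hC : τ (ι₂ (X c)) = ι₂ (X c * v₂)) (hA : τ (ι₂ (X a)) = ι₂ (X a) * iv₂ ^ 7)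
    (hB : τ (ι₂ (X b)) = ι₂ (X b + X c ^ 3 * X a) * iv₂ ^ 4)
    (hD : τ (ι₂ (X d)) = ι₂ (X d + X c ^ 3 - X c ^ 15 * X a ^ 2))
    (hfix : ∀ i, i ≠ a → i ≠ b → i ≠ c → i ≠ d → τ (ι₂ (X i)) = ι₂ (X i))
    (y : HomogeneousLocalization.Away (reesGrading I) s) :
    (∀ g, HomogeneousLocalization.map (φ g) (hP g) y = y) ↔ τ (e y) = e y := by
  classical
  -- `e (w/1)` is a non-zero-divisor of the domain `L₂`
  have hu0 : u₂ ≠ 0 := by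
    intro h
    have h' := congrArg MvPolynomial.constantCoeff h
    simp [MvPolynomial.constantCoeff_X] at h'
  haveI : IsDomain L₂ :=
    IsLocalization.isDomain_of_le_nonZeroDivisors _ (powers_le_nonZeroDivisors_of_noZeroDivisors hu0)
  have hinj : Function.Injective ι₂ :=
    IsLocalization.injective _ (powers_le_nonZeroDivisors_of_noZeroDivisors hu0)
  have hnzd : e (((fromZeroRingHom (reesGrading I) (.powers s)).comp (reesGrading.zeroRingHom I)) w) ∈
      nonZeroDivisors L₂ := by
    rw [he_base]
    refine mem_nonZeroDivisors_of_ne_zero fun h => hw0 (hinj ?_)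
    rw [h, map_zero]
  -- the intertwining on base elements
  have hSg : ∀ r, (τ : L₂ →+* L₂) (e (((fromZeroRingHom (reesGrading I) (.powers s)).comp
      (reesGrading.zeroRingHom I)) r)) =
      e (((fromZeroRingHom (reesGrading I) (.powers s)).comp (reesGrading.zeroRingHom I)) (σ r)) := by
    intro r
    rw [he_base, he_base]
    exact lift_comp_term k n a b c d σ hb hc hd hσ hab hac had hbc hbd τ hC hA hB hD hfix r
  exact BlowupExit.map_away_fixed_iff_of_intertwines σ s hs w hsw hw φ hφ hP e he hnzd
    (τ : L₂ →+* L₂) hSg y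

end Summit.ResolutionOfSingularities.ResolutionOfSingularities.Theorems.WildQuotientResolution.Z9Peeled.Terminal

end
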